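import Literature.NumberTheory.EllipticCurves.ManinConstantClassCertificate
import Literature.NumberTheory.EllipticCurves.QuadraticTwistJInvariantProofs
import Literature.NumberTheory.EllipticCurves.IsogenyVariableChangeProofs
import HarnessLib

/-!
# Route `TwistFamilyManinDescent` — crux `IsogenyTableFamiliesManinOne` (stmt-BirchSwinnertonDyer-25137, rank 3):
# the REDUCTION of a whole `j`-family to a finite certificate on one base curve (`--supports`)

HONEST FRAMING. Theorems only; the crux 25137 (|c| = 1 on the eleven Mazur–Kenku isogeny-table `j`-families) is NOT
closed here. What is proved is its STRUCTURE: granted modularity, once a base curve `E₀` with `j(E₀) = j₀ ∉ {0, 1728}`,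
a number `A` divisible by every odd additive prime of `E₀`, and the FINITE certificate «`ClassAbsManinConstantEqOne
(E₀ ⊗ d₀)` for every square-free integer `d₀` supported on the primes of `2A`» (both signs) are supplied, EVERY elliptic
`W/ℚ` with `j(W) = j₀` satisfies the class Manin certificate (`classAbsManinConstantEqOne_of_j_eq_of_certificates`).
The engine is the whole-family descent of item 25136 (landed as `twistFamilyDescent_proof`; taken here as the
HYPOTHESIS `hT` in its unfolded shape so that this file imports no route file): `W ≅ E₀ ⊗ d`
(`exists_variableChange_eq_quadraticTwist_of_j_eq`), `d` made integral and split as `d₀ · d₁ · b²` with `d₀` square-free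
supported on `2A` and `d₁` coprime to `2A·d₀` (`Nat.sq_mul_squarefree_of_pos` + a gcd split), squares removed by a
change of variables. The per-family certificates (conductors of the ≤ 16 inner twists `≤ 5·10⁵`, Cremona) are the
remaining finite work of 25137 and are NOT supplied here. BSD is not proved by this; Manin's conjecture is not proved.
-/

-- D-0017: single-problem summit, so `Summit.BirchSwinnertonDyer.BirchSwinnertonDyer.…` repeats a namespace BY DESIGN.
set_option linter.dupNamespace false
set_option autoImplicit false

noncomputable section

open scoped Classical

open WeierstrassCurve Literature.NumberTheory.EllipticCurves Literature.NumberTheory.EllipticCurves.ModularForms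

namespace Summit.BirchSwinnertonDyer.BirchSwinnertonDyer.Theorems.TwistFamilyManinDescent

/-! ### §1 Square-free splitting of an integer relative to a finite set of primes -/

/-- **Relative square-free splitting.** Every non-zero integer `D` is `d₀ · d₁ · b²` with `b ≠ 0`, `d₀` square-free
and supported on the primes of `M`, and `d₁` coprime to `M · d₀`. (`|D| = b²·a` with `a` square-free,
`a₀ = gcd(a, M)`, `d₀ = sign(D)·a₀`, `d₁ = a/a₀`.) [elementary] -/
theorem exists_squarefree_split (D : ℤ) (hD : D ≠ 0) (M : ℕ) :
    ∃ (d₀ d₁ b : ℤ), b ≠ 0 ∧ d₀ ≠ 0 ∧ d₁ ≠ 0 ∧ D = d₀ * d₁ * b ^ 2 ∧ Squarefree d₀ ∧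
      (∀ q : ℕ, q.Prime → (q : ℤ) ∣ d₀ → q ∣ M) ∧ IsCoprime d₁ ((M : ℤ) * d₀) := by
  obtain ⟨a, b, ha, hb, hab, hsq⟩ := Nat.sq_mul_squarefree_of_pos (Int.natAbs_pos.mpr hD)
  set a₀ : ℕ := Nat.gcd a M with ha₀
  have ha₀pos : 0 < a₀ := Nat.gcd_pos_of_pos_left _ ha
  have ha₀a : a₀ ∣ a := Nat.gcd_dvd_left a M
  have ha₀M : a₀ ∣ M := Nat.gcd_dvd_right a M
  obtain ⟨a₁, ha₁⟩ := ha₀a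
  have ha₁pos : 0 < a₁ := Nat.pos_of_ne_zero fun h ↦ by rw [h, mul_zero] at ha₁; omega
  -- `a₁` is coprime to `M` and to `a₀` (square-freeness of `a = a₀ a₁`)
  have hcopM : Nat.Coprime a₁ M := by
    refine Nat.coprime_of_dvd fun k hk hka₁ hkM ↦ ?_
    have hka₀ : k ∣ a₀ := Nat.dvd_gcd (ha₁ ▸ Dvd.dvd.mul_left hka₁ a₀) hkM
    have hkk : k * k ∣ a := ha₁ ▸ mul_dvd_mul hka₀ hka₁
    exact hk.one_lt.ne' (Nat.isUnit_iff.mp (hsq k hkk))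
  have hcop₀ : Nat.Coprime a₁ a₀ := by
    refine Nat.coprime_of_dvd fun k hk hka₁ hka₀ ↦ ?_
    have hkk : k * k ∣ a := ha₁ ▸ mul_dvd_mul hka₀ hka₁
    exact hk.one_lt.ne' (Nat.isUnit_iff.mp (hsq k hkk))
  have hsign : D.sign = 1 ∨ D.sign = -1 := by
    rcases lt_or_gt_of_ne hD with h | h
    · exact Or.inr (Int.sign_eq_neg_one_of_neg h)
    · exact Or.inl (Int.sign_eq_one_of_pos h)
  refine ⟨D.sign * a₀, a₁, b, by exact_mod_cast hb.ne', ?_, by exact_mod_cast ha₁pos.ne', ?_, ?_, ?_, ?_⟩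
  · refine mul_ne_zero ?_ (by exact_mod_cast ha₀pos.ne')
    rcases hsign with h | h <;> rw [h] <;> norm_num
  · -- `D = sign(D)·|D| = sign(D)·b²·a₀·a₁`
    have h1 : (D.natAbs : ℤ) = (b : ℤ) ^ 2 * (a₀ * a₁ : ℕ) := by rw [← ha₁, ← hab]; push_cast; ring
    calc D = D.sign * (D.natAbs : ℤ) := (Int.sign_mul_natAbs D).symm
      _ = D.sign * a₀ * a₁ * b ^ 2 := by rw [h1]; push_cast; ring
  · -- square-free: `a₀ ∣ a`, and the sign is a unit
    have hsq₀ : Squarefree (a₀ : ℤ) :=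
      Int.squarefree_natCast.mpr (hsq.squarefree_of_dvd ⟨a₁, ha₁⟩)
    rcases hsign with h | h <;> rw [h]
    · simpa using hsq₀
    · exact hsq₀.squarefree_of_dvd ⟨-1, by ring⟩
  · intro q hq hqd
    have hq' : (q : ℤ) ∣ (a₀ : ℤ) := by
      rcases hsign with h | h <;> rw [h] at hqd
      · simpa using hqd
      · rwa [neg_one_mul, dvd_neg] at hqd
    exact (Int.natCast_dvd_natCast.mp hq').trans ha₀M
  · -- `a₁` coprime to `M · sign(D) · a₀`
    have hc : Nat.Coprime a₁ (M * a₀) := Nat.Coprime.mul_right hcopM hcop₀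
    have hcZ : IsCoprime (a₁ : ℤ) ((M * a₀ : ℕ) : ℤ) := Nat.isCoprime_iff_coprime.mpr hc
    rcases hsign with h | h <;> rw [h]
    · simpa [mul_comm, mul_assoc] using hcZ
    · have : ((M : ℤ) * (-1 * a₀)) = -((M * a₀ : ℕ) : ℤ) := by push_cast; ring
      rw [this]
      exact hcZ.neg_right

/-! ### §2 The reduction of a `j`-family to the base certificate -/

/-- **A whole `j`-family from one base curve and a finite certificate** (the structure of crux 25137). Let
`E₀/ℚ` be elliptic with `j(E₀) ∉ {0, 1728}` and `A : ℕ`; assume the WHOLE-FAMILY DESCENT `hT` for `(E₀, A)` (the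
conclusion of item 25136 `TwistFamilyDescent`, landed as `twistFamilyDescent_proof`, granted modularity and `A`
divisible by the odd additive primes of `E₀`) and the finite certificate: `ClassAbsManinConstantEqOne (E₀ ⊗ d₀)` for
EVERY non-zero square-free integer `d₀` all of whose prime factors divide `2A`. Then every elliptic `W/ℚ` with
`j(W) = j(E₀)` satisfies `ClassAbsManinConstantEqOne W`: `W ≅ E₀ ⊗ d`
(`exists_variableChange_eq_quadraticTwist_of_j_eq`), `d` made integral and split `d = d₀ d₁ b²` (§1), squares
removed (`exists_variableChange_quadraticTwist_mul_sq`, class invariance), then `hT` along `d₁`.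
[cite: SilvermanAEC2009, X.5 Cor. 5.4] [cite: Stevens1989, Lemmas (5.2), (5.4)] -/
theorem classAbsManinConstantEqOne_of_j_eq_of_certificates
    (E₀ : WeierstrassCurve ℚ) [E₀.IsElliptic] (h0 : E₀.j ≠ 0) (h1728 : E₀.j ≠ 1728) (A : ℕ)
    (hT : ∀ d₀ d₁ : ℤ, d₀ ≠ 0 → d₁ ≠ 0 → IsCoprime d₁ (2 * A * d₀) →
      ClassAbsManinConstantEqOne (E₀.quadraticTwist ((d₀ : ℤ) : ℚ)) →
      ClassAbsManinConstantEqOne (E₀.quadraticTwist ((-d₀ : ℤ) : ℚ)) →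
      ClassAbsManinConstantEqOne (E₀.quadraticTwist ((d₀ * d₁ : ℤ) : ℚ)))
    (hcert : ∀ d₀ : ℤ, d₀ ≠ 0 → Squarefree d₀ → (∀ q : ℕ, q.Prime → (q : ℤ) ∣ d₀ → q ∣ 2 * A) →
      ClassAbsManinConstantEqOne (E₀.quadraticTwist ((d₀ : ℤ) : ℚ)))
    (W : WeierstrassCurve ℚ) [W.IsElliptic] (hjW : W.j = E₀.j) : ClassAbsManinConstantEqOne W := by
  -- `W ≅ E₀ ⊗ d`
  obtain ⟨d, hd0, C, hC⟩ := exists_variableChange_eq_quadraticTwist_of_j_eq hjW h0 h1728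
  haveI := E₀.isElliptic_quadraticTwist hd0
  suffices h : ClassAbsManinConstantEqOne (E₀.quadraticTwist d) from
    h.of_isIsogenous (isIsogenous_of_smul_eq' hC)
  -- `d` made integral: `E₀ ⊗ d ≅ E₀ ⊗ (d · den²) = E₀ ⊗ D`, `D = num · den`
  set D : ℤ := d.num * d.den with hDdef
  have hD0 : D ≠ 0 := mul_ne_zero (Rat.num_ne_zero.mpr hd0) (by exact_mod_cast d.den_nz)
  have hdD : d * (d.den : ℚ) ^ 2 = ((D : ℤ) : ℚ) := by
    rw [hDdef]; push_cast; rw [sq, ← mul_assoc, Rat.mul_den_eq_num]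
  have hden0 : (d.den : ℚ) ≠ 0 := by exact_mod_cast d.den_nz
  obtain ⟨C₁, hC₁⟩ := exists_variableChange_quadraticTwist_mul_sq E₀ d (d.den : ℚ) hden0
  rw [hdD] at hC₁
  haveI : (E₀.quadraticTwist ((D : ℤ) : ℚ)).IsElliptic := E₀.isElliptic_quadraticTwist (by exact_mod_cast hD0)
  suffices h : ClassAbsManinConstantEqOne (E₀.quadraticTwist ((D : ℤ) : ℚ)) from
    h.of_isIsogenous (isIsogenous_of_smul_eq' hC₁)
  -- split `D = d₀ d₁ b²` relative to `2A`
  obtain ⟨d₀, d₁, b, hb0, hd₀0, hd₁0, hsplit, hsq₀, hsupp, hcop⟩ := exists_squarefree_split D hD0 (2 * A)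
  have hd01 : ((d₀ * d₁ : ℤ) : ℚ) ≠ 0 := by exact_mod_cast mul_ne_zero hd₀0 hd₁0
  haveI : (E₀.quadraticTwist ((d₀ * d₁ : ℤ) : ℚ)).IsElliptic := E₀.isElliptic_quadraticTwist hd01
  have hcast : ((D : ℤ) : ℚ) = ((d₀ * d₁ : ℤ) : ℚ) * ((b : ℤ) : ℚ) ^ 2 := by rw [hsplit]; push_cast; ring
  obtain ⟨C₂, hC₂⟩ :=
    exists_variableChange_quadraticTwist_mul_sq E₀ ((d₀ * d₁ : ℤ) : ℚ) ((b : ℤ) : ℚ) (by exact_mod_cast hb0)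
  rw [← hcast] at hC₂
  suffices h : ClassAbsManinConstantEqOne (E₀.quadraticTwist ((d₀ * d₁ : ℤ) : ℚ)) from
    h.of_isIsogenous (isIsogenous_of_smul_eq hC₂)
  -- the whole-family descent along `d₁`
  have hcop' : IsCoprime d₁ (2 * (A : ℤ) * d₀) := by
    have : (2 * (A : ℤ) * d₀) = (((2 * A : ℕ) : ℤ) * d₀) := by push_cast; ring
    rw [this]; exact hcop
  refine hT d₀ d₁ hd₀0 hd₁0 hcop' (hcert d₀ hd₀0 hsq₀ hsupp) ?_
  refine hcert (-d₀) (neg_ne_zero.mpr hd₀0) (hsq₀.squarefree_of_dvd ⟨-1, by ring⟩) fun q hq hqd ↦ ?_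
  exact hsupp q hq (dvd_neg.mp hqd)

end Summit.BirchSwinnertonDyer.BirchSwinnertonDyer.Theorems.TwistFamilyManinDescent

end
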